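import Literature.Probability.ODonnellSaksSchrammServedio2005.StrategyTree
import Mathlib.Combinatorics.SetFamily.FourFunctions
import HarnessLib

/-!
# Conditioning a positive FKG-lattice weight on the Boolean cube on cylinder events: towers, Holley
# monotonicity in the boundary condition, and the one-edge total-covariance inequality

Claimed R42 (8)(c) in the cell INBOX at 2026-08-28T01:24:06Z by fkp-10a gen 352 (NEW CLAIM #1 of the gen) under provision (ι) (no coordinator fk-4 seated since gen 263 closed, cell INBOX l.8248; the lane lead absorbs the registry word; silence = consent; a seated coordinator's word would govern); lineage row FO-10a-g352 (self-suggested), package g352-osss, label OS-A.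
Support file of the `fk-continuity` cell (lineage fkp-10a, `--supports stmt-CriticalPhenomena-4575`); builds on
p205010 (kernel theorem, internal audit signed; external expert review pending).  No definitions, no named facts,
no sorries; standard axioms.  GENERIC finite-probability-space theory (any finite index type `ι`; no lattice, no `d`,
no `q`): the decision-tree input of the OSSS / sharpness programme for the random-cluster model
(Duminil-Copin–Raoufi–Tassion 2019, Thm 1.2), whose instantiation to the wired FK box measures on `ℤ^d` is the
business of the later files of package `g352-osss`.

Setting: a finite index type `ι`, a weight `μ : (ι → Bool) → ℝ` with `μ > 0` and the FKG lattice condition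
`μ(a) μ(b) ≤ μ(a ⊓ b) μ(a ⊔ b)`.  For a finite set `D` of coordinates and values `ξ : ι → Bool` the CYLINDER WEIGHT
`w D ξ x = μ x · 𝟙{x = ξ on D}` is `μ` conditioned (unnormalised) on `{ω_D = ξ_D}`; `Z D ξ` is its mass,
`Pr D ξ e = Z (insert e D) ξ^{e→1} / Z D ξ` the conditional probability that `ω_e = 1`, and `Eg D ξ` the conditional
expectation of a fixed `g`.  To keep this support file free of definitions, `w, Z, Pr, Eg` are VARIABLES constrained by
their defining equations (`hw, hZ, hPr, hEg`); the consumer (`OSSSMonotonicMeasures.lean`) instantiates them by the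
explicit closed forms.  Proved: refinement of cylinders one coordinate at a time (`w_insert`, `sum_w_mul_split`),
positivity of masses, `0 < Pr < 1`, the tower identities, HOLLEY MONOTONICITY of conditional expectations of increasing
functions in the boundary condition `ξ` (Grimmett 2006 Thm (2.24)/(2.27): a positive measure with the FKG lattice
condition is monotonic; via Mathlib's `holley`), and the one-edge total-covariance inequality
`Pr·Cov(g,ω_j | ω_e=1) + (1−Pr)·Cov(g,ω_j | ω_e=0) ≤ Cov(g,ω_j)` (the two conditional expectations are increasing in
`ω_e`).  Finite sums only; no measure theory.

## References
* G. Grimmett, *The Random-Cluster Model*, Springer 2006, §2.2 Thm (2.24), (2.27) (monotonic measures), Thm (2.19)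
  (Holley). [Grimmett2006]
* H. Duminil-Copin, A. Raoufi, V. Tassion, Ann. of Math. 189 (2019) 75–99, §1.1 (monotonic measures), §2.
  [DuminilCopinRaoufiTassion2019]
-/

namespace Summit.CriticalPhenomena.PercolationContinuityZ3.Theorems.FK

namespace MonotonicOSSS

open Finset Function

variable {ι : Type*} [Fintype ι] [DecidableEq ι]

variable (μ g : (ι → Bool) → ℝ) (w : Finset ι → (ι → Bool) → (ι → Bool) → ℝ) (Z : Finset ι → (ι → Bool) → ℝ)
  (Pr : Finset ι → (ι → Bool) → ι → ℝ) (Eg : Finset ι → (ι → Bool) → ℝ)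

/-! ### Cylinders refined one coordinate at a time -/

omit [Fintype ι] in
/-- Membership in the refined cylinder `{ω = ξ^{e→b} on D ∪ {e}}`: `ω_e = b` and `ω = ξ` on `D` (`e ∉ D`).
[cite: Grimmett2006, §2.2 (2.20)–(2.21) (conditioning on the configuration off F)] -/
theorem cyl_insert_iff {D : Finset ι} {e : ι} (he : e ∉ D) (ξ x : ι → Bool) (b : Bool) :
    (∀ i ∈ insert e D, x i = update ξ e b i) ↔ x e = b ∧ ∀ i ∈ D, x i = ξ i := by
  rw [Finset.forall_mem_insert, update_self]
  refine and_congr_right fun _ => forall₂_congr fun i hi => ?_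
  rw [update_of_ne (ne_of_mem_of_not_mem hi he)]

/-- REFINEMENT: `w (D ∪ {e}) ξ^{e→b} x = w D ξ x · 𝟙{x_e = b}` for `e ∉ D`.
[cite: Grimmett2006, §2.2 (2.20)–(2.21)] -/
theorem w_insert (hw : ∀ D ξ x, w D ξ x = if (∀ i ∈ D, x i = ξ i) then μ x else 0) {D : Finset ι} {e : ι}
    (he : e ∉ D) (ξ x : ι → Bool) (b : Bool) :
    w (insert e D) (update ξ e b) x = w D ξ x * (if x e = b then 1 else 0) := by
  rw [hw, hw]
  have key : (∀ i ∈ insert e D, x i = update ξ e b i) ↔ x e = b ∧ ∀ i ∈ D, x i = ξ i := cyl_insert_iff he ξ x b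
  by_cases h1 : x e = b
  · by_cases h2 : (∀ i ∈ D, x i = ξ i)
    · rw [if_pos (key.2 ⟨h1, h2⟩), if_pos h2, if_pos h1, mul_one]
    · rw [if_neg (fun h => h2 (key.1 h).2), if_neg h2, zero_mul]
  · rw [if_neg (fun h => h1 (key.1 h).1), if_neg h1, mul_zero]

/-- `w ≥ 0`. [cite: Grimmett2006, §2.2 (2.20)] -/
theorem w_nonneg (hw : ∀ D ξ x, w D ξ x = if (∀ i ∈ D, x i = ξ i) then μ x else 0) (hμ0 : ∀ x, 0 < μ x)
    (D : Finset ι) (ξ x : ι → Bool) : 0 ≤ w D ξ x := by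
  rw [hw]; split_ifs
  · exact (hμ0 x).le
  · exact le_rfl

/-- `w D ξ x ≤ μ x`. [cite: Grimmett2006, §2.2 (2.20)] -/
theorem w_le (hw : ∀ D ξ x, w D ξ x = if (∀ i ∈ D, x i = ξ i) then μ x else 0) (hμ0 : ∀ x, 0 < μ x)
    (D : Finset ι) (ξ x : ι → Bool) : w D ξ x ≤ μ x := by
  rw [hw]; split_ifs
  · exact le_rfl
  · exact (hμ0 x).le

/-- The boundary condition itself lies in its cylinder: `w D ξ ξ = μ ξ`. [cite: Grimmett2006, §2.2 (2.20)] -/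
theorem w_self (hw : ∀ D ξ x, w D ξ x = if (∀ i ∈ D, x i = ξ i) then μ x else 0) (D : Finset ι) (ξ : ι → Bool) :
    w D ξ ξ = μ ξ := by
  rw [hw, if_pos (fun i _ => rfl)]

/-- With no coordinate fixed the cylinder weight is `μ`. [cite: Grimmett2006, §2.2 (2.20)] -/
theorem w_empty (hw : ∀ D ξ x, w D ξ x = if (∀ i ∈ D, x i = ξ i) then μ x else 0) (ξ x : ι → Bool) :
    w ∅ ξ x = μ x := by
  rw [hw, if_pos (fun i hi => absurd hi (Finset.notMem_empty i))]

/-- SPLITTING A CONDITIONAL SUM along the value of a further coordinate `e ∉ D`: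
`Σ_x w D ξ x h x = Σ_x w (D∪e) ξ^{e→1} x h x + Σ_x w (D∪e) ξ^{e→0} x h x`. [cite: Grimmett2006, §2.2 (2.21)] -/
theorem sum_w_mul_split (hw : ∀ D ξ x, w D ξ x = if (∀ i ∈ D, x i = ξ i) then μ x else 0) {D : Finset ι} {e : ι}
    (he : e ∉ D) (ξ : ι → Bool) (h : (ι → Bool) → ℝ) :
    ∑ x, w D ξ x * h x = ∑ x, w (insert e D) (update ξ e true) x * h x
      + ∑ x, w (insert e D) (update ξ e false) x * h x := by
  rw [← Finset.sum_add_distrib]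
  refine Finset.sum_congr rfl fun x _ => ?_
  rw [w_insert μ w hw he, w_insert μ w hw he]
  rcases Bool.eq_false_or_eq_true (x e) with hx | hx <;> simp [hx]

/-- A conditional sum against `𝟙{x_e = b}·h` is the refined conditional sum of `h`.
[cite: Grimmett2006, §2.2 (2.21)] -/
theorem sum_w_mul_ite (hw : ∀ D ξ x, w D ξ x = if (∀ i ∈ D, x i = ξ i) then μ x else 0) {D : Finset ι} {e : ι}
    (he : e ∉ D) (ξ : ι → Bool) (b : Bool) (h : (ι → Bool) → ℝ) :
    ∑ x, w D ξ x * ((if x e = b then 1 else 0) * h x) = ∑ x, w (insert e D) (update ξ e b) x * h x := by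
  refine Finset.sum_congr rfl fun x _ => ?_
  rw [w_insert μ w hw he, mul_assoc]

/-- Under the refined weight `w (D∪e) ξ^{e→b}` an integrand may be evaluated as if `x_e = b`: if `h x = h' x` whenever
`x_e = b` then the two conditional sums agree. [cite: Grimmett2006, §2.2 (2.21)] -/
theorem sum_w_insert_congr (hw : ∀ D ξ x, w D ξ x = if (∀ i ∈ D, x i = ξ i) then μ x else 0) {D : Finset ι} {e : ι}
    (he : e ∉ D) (ξ : ι → Bool) (b : Bool) {h h' : (ι → Bool) → ℝ} (hh : ∀ x, x e = b → h x = h' x) :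
    ∑ x, w (insert e D) (update ξ e b) x * h x = ∑ x, w (insert e D) (update ξ e b) x * h' x := by
  refine Finset.sum_congr rfl fun x _ => ?_
  rw [w_insert μ w hw he]
  by_cases hx : x e = b
  · rw [hh x hx]
  · rw [if_neg hx, mul_zero, zero_mul, zero_mul]

/-! ### Masses and one-edge conditional probabilities -/

/-- POSITIVITY OF CYLINDER MASSES (`μ > 0`): `0 < Z D ξ`. [cite: Grimmett2006, §2.2 (positivity, (2.20))] -/
theorem Z_pos (hw : ∀ D ξ x, w D ξ x = if (∀ i ∈ D, x i = ξ i) then μ x else 0) (hZ : ∀ D ξ, Z D ξ = ∑ x, w D ξ x)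
    (hμ0 : ∀ x, 0 < μ x) (D : Finset ι) (ξ : ι → Bool) : 0 < Z D ξ := by
  rw [hZ]
  calc (0 : ℝ) < μ ξ := hμ0 ξ
    _ = w D ξ ξ := (w_self μ w hw D ξ).symm
    _ ≤ ∑ x, w D ξ x := Finset.single_le_sum (fun x _ => w_nonneg μ w hw hμ0 D ξ x) (Finset.mem_univ ξ)

/-- `Z D ξ = Z (D∪e) ξ^{e→1} + Z (D∪e) ξ^{e→0}` (`e ∉ D`). [cite: Grimmett2006, §2.2 (2.21)] -/
theorem Z_split (hw : ∀ D ξ x, w D ξ x = if (∀ i ∈ D, x i = ξ i) then μ x else 0) (hZ : ∀ D ξ, Z D ξ = ∑ x, w D ξ x)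
    {D : Finset ι} {e : ι} (he : e ∉ D) (ξ : ι → Bool) :
    Z D ξ = Z (insert e D) (update ξ e true) + Z (insert e D) (update ξ e false) := by
  have h := sum_w_mul_split μ w hw he ξ (fun _ => 1)
  simp only [mul_one] at h
  rw [hZ, hZ, hZ, h]

/-- `Pr D ξ e = E[𝟙{ω_e = 1} | ω_D = ξ_D]` as a conditional sum (`e ∉ D`). [cite: Grimmett2006, §2.2 (2.22)–(2.23)] -/
theorem Pr_eq_sum (hw : ∀ D ξ x, w D ξ x = if (∀ i ∈ D, x i = ξ i) then μ x else 0) (hZ : ∀ D ξ, Z D ξ = ∑ x, w D ξ x)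
    (hPr : ∀ D ξ e, Pr D ξ e = Z (insert e D) (update ξ e true) / Z D ξ) {D : Finset ι} {e : ι} (he : e ∉ D)
    (ξ : ι → Bool) : Pr D ξ e = (∑ x, w D ξ x * (if x e = true then 1 else 0)) / Z D ξ := by
  rw [hPr, hZ (insert e D)]
  congr 1
  exact Finset.sum_congr rfl fun x _ => w_insert μ w hw he ξ x true

/-- `0 < Pr D ξ e` (`e ∉ D`). [cite: Grimmett2006, §2.2 (finite energy of a positive measure)] -/
theorem Pr_pos (hw : ∀ D ξ x, w D ξ x = if (∀ i ∈ D, x i = ξ i) then μ x else 0) (hZ : ∀ D ξ, Z D ξ = ∑ x, w D ξ x)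
    (hPr : ∀ D ξ e, Pr D ξ e = Z (insert e D) (update ξ e true) / Z D ξ) (hμ0 : ∀ x, 0 < μ x) (D : Finset ι)
    (ξ : ι → Bool) (e : ι) : 0 < Pr D ξ e := by
  rw [hPr]; exact div_pos (Z_pos μ w Z hw hZ hμ0 _ _) (Z_pos μ w Z hw hZ hμ0 _ _)

/-- `1 - Pr D ξ e = Z (D∪e) ξ^{e→0} / Z D ξ` (`e ∉ D`). [cite: Grimmett2006, §2.2 (2.21)] -/
theorem one_sub_Pr (hw : ∀ D ξ x, w D ξ x = if (∀ i ∈ D, x i = ξ i) then μ x else 0) (hZ : ∀ D ξ, Z D ξ = ∑ x, w D ξ x)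
    (hPr : ∀ D ξ e, Pr D ξ e = Z (insert e D) (update ξ e true) / Z D ξ) (hμ0 : ∀ x, 0 < μ x) {D : Finset ι} {e : ι}
    (he : e ∉ D) (ξ : ι → Bool) : 1 - Pr D ξ e = Z (insert e D) (update ξ e false) / Z D ξ := by
  have hZ0 := (Z_pos μ w Z hw hZ hμ0 D ξ).ne'
  rw [hPr, eq_div_iff hZ0, sub_mul, div_mul_cancel₀ _ hZ0, one_mul, Z_split μ w Z hw hZ he ξ]
  ring

/-- `Pr D ξ e < 1` (`e ∉ D`). [cite: Grimmett2006, §2.2 (finite energy of a positive measure)] -/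
theorem Pr_lt_one (hw : ∀ D ξ x, w D ξ x = if (∀ i ∈ D, x i = ξ i) then μ x else 0) (hZ : ∀ D ξ, Z D ξ = ∑ x, w D ξ x)
    (hPr : ∀ D ξ e, Pr D ξ e = Z (insert e D) (update ξ e true) / Z D ξ) (hμ0 : ∀ x, 0 < μ x) {D : Finset ι} {e : ι}
    (he : e ∉ D) (ξ : ι → Bool) : Pr D ξ e < 1 := by
  have h := one_sub_Pr μ w Z Pr hw hZ hPr hμ0 he ξ
  have : 0 < Z (insert e D) (update ξ e false) / Z D ξ := div_pos (Z_pos μ w Z hw hZ hμ0 _ _) (Z_pos μ w Z hw hZ hμ0 _ _)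
  linarith

/-! ### Towers -/

/-- THE TOWER IDENTITY for conditional expectations along a further coordinate `e ∉ D`:
`E[h | ξ_D] = Pr · E[h | ξ_D, ω_e=1] + (1 − Pr) · E[h | ξ_D, ω_e=0]`. [cite: Grimmett2006, §2.2 (2.21)] -/
theorem condexp_tower (hw : ∀ D ξ x, w D ξ x = if (∀ i ∈ D, x i = ξ i) then μ x else 0)
    (hZ : ∀ D ξ, Z D ξ = ∑ x, w D ξ x) (hPr : ∀ D ξ e, Pr D ξ e = Z (insert e D) (update ξ e true) / Z D ξ)
    (hμ0 : ∀ x, 0 < μ x) {D : Finset ι} {e : ι} (he : e ∉ D) (ξ : ι → Bool) (h : (ι → Bool) → ℝ) :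
    (∑ x, w D ξ x * h x) / Z D ξ
      = Pr D ξ e * ((∑ x, w (insert e D) (update ξ e true) x * h x) / Z (insert e D) (update ξ e true))
        + (1 - Pr D ξ e) * ((∑ x, w (insert e D) (update ξ e false) x * h x) / Z (insert e D) (update ξ e false)) := by
  rw [one_sub_Pr μ w Z Pr hw hZ hPr hμ0 he ξ, hPr, sum_w_mul_split μ w hw he ξ h, add_div]
  have h1 := (Z_pos μ w Z hw hZ hμ0 (insert e D) (update ξ e true)).ne'
  have h0 := (Z_pos μ w Z hw hZ hμ0 (insert e D) (update ξ e false)).ne'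
  congr 1
  · rw [div_mul_div_comm, mul_comm (Z (insert e D) (update ξ e true)), ← div_mul_div_comm, div_self h1, mul_one]
  · rw [div_mul_div_comm, mul_comm (Z (insert e D) (update ξ e false)), ← div_mul_div_comm, div_self h0, mul_one]

/-- `E[h·𝟙{ω_e=1} | ξ_D] = Pr · E[h | ξ_D, ω_e = 1]` (`e ∉ D`). [cite: Grimmett2006, §2.2 (2.21)] -/
theorem condexp_mul_ite (hw : ∀ D ξ x, w D ξ x = if (∀ i ∈ D, x i = ξ i) then μ x else 0)
    (hZ : ∀ D ξ, Z D ξ = ∑ x, w D ξ x) (hPr : ∀ D ξ e, Pr D ξ e = Z (insert e D) (update ξ e true) / Z D ξ)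
    (hμ0 : ∀ x, 0 < μ x) {D : Finset ι} {e : ι} (he : e ∉ D) (ξ : ι → Bool) (h : (ι → Bool) → ℝ) :
    (∑ x, w D ξ x * (h x * if x e = true then 1 else 0)) / Z D ξ
      = Pr D ξ e * ((∑ x, w (insert e D) (update ξ e true) x * h x) / Z (insert e D) (update ξ e true)) := by
  have h1 := (Z_pos μ w Z hw hZ hμ0 (insert e D) (update ξ e true)).ne'
  have hre : ∑ x, w D ξ x * (h x * if x e = true then 1 else 0)
      = ∑ x, w D ξ x * ((if x e = true then 1 else 0) * h x) :=
    Finset.sum_congr rfl fun x _ => by ring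
  rw [hre, sum_w_mul_ite μ w hw he ξ true h, hPr, div_mul_div_comm, mul_comm (Z (insert e D) (update ξ e true)),
    ← div_mul_div_comm, div_self h1, mul_one]

/-- Tower for `Eg`: `Eg D ξ = Pr · Eg (D∪e) ξ^{e→1} + (1 − Pr) · Eg (D∪e) ξ^{e→0}`.
[cite: Grimmett2006, §2.2 (2.21)] -/
theorem Eg_tower (hw : ∀ D ξ x, w D ξ x = if (∀ i ∈ D, x i = ξ i) then μ x else 0)
    (hZ : ∀ D ξ, Z D ξ = ∑ x, w D ξ x) (hPr : ∀ D ξ e, Pr D ξ e = Z (insert e D) (update ξ e true) / Z D ξ)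
    (hEg : ∀ D ξ, Eg D ξ = (∑ x, w D ξ x * g x) / Z D ξ) (hμ0 : ∀ x, 0 < μ x) {D : Finset ι} {e : ι} (he : e ∉ D)
    (ξ : ι → Bool) :
    Eg D ξ = Pr D ξ e * Eg (insert e D) (update ξ e true) + (1 - Pr D ξ e) * Eg (insert e D) (update ξ e false) := by
  rw [hEg, hEg, hEg]; exact condexp_tower μ w Z Pr hw hZ hPr hμ0 he ξ g

/-! ### Holley monotonicity in the boundary condition -/

/-- THE HOLLEY CONDITION for two cylinders over the same coordinates with ordered boundary conditions `ξ₀ ≤ ξ₁`: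
`w D ξ₀ a · w D ξ₁ b ≤ w D ξ₀ (a ⊓ b) · w D ξ₁ (a ⊔ b)` (the FKG lattice condition of `μ` and closure of the two
cylinders under `⊓`/`⊔`). [cite: Grimmett2006, §2.2 Thm (2.24), proof ((b) ⟹ (c) via Holley, (2.28)–(2.29))] -/
theorem w_holley (hw : ∀ D ξ x, w D ξ x = if (∀ i ∈ D, x i = ξ i) then μ x else 0) (hμ0 : ∀ x, 0 < μ x)
    (hμ : ∀ a b, μ a * μ b ≤ μ (a ⊓ b) * μ (a ⊔ b)) (D : Finset ι) {ξ₀ ξ₁ : ι → Bool} (h01 : ξ₀ ≤ ξ₁)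
    (a b : ι → Bool) : w D ξ₀ a * w D ξ₁ b ≤ w D ξ₀ (a ⊓ b) * w D ξ₁ (a ⊔ b) := by
  by_cases ha : ∀ i ∈ D, a i = ξ₀ i
  swap
  · rw [hw D ξ₀ a, if_neg ha, zero_mul]
    exact mul_nonneg (w_nonneg μ w hw hμ0 _ _ _) (w_nonneg μ w hw hμ0 _ _ _)
  by_cases hb : ∀ i ∈ D, b i = ξ₁ i
  swap
  · rw [hw D ξ₁ b, if_neg hb, mul_zero]
    exact mul_nonneg (w_nonneg μ w hw hμ0 _ _ _) (w_nonneg μ w hw hμ0 _ _ _)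
  have hab0 : ∀ i ∈ D, (a ⊓ b) i = ξ₀ i := fun i hi => by
    rw [Pi.inf_apply, ha i hi, hb i hi]; exact inf_eq_left.2 (h01 i)
  have hab1 : ∀ i ∈ D, (a ⊔ b) i = ξ₁ i := fun i hi => by
    rw [Pi.sup_apply, ha i hi, hb i hi]; exact sup_eq_right.2 (h01 i)
  rw [hw, if_pos ha, hw, if_pos hb, hw, if_pos hab0, hw, if_pos hab1]
  exact hμ a b

/-- HOLLEY MONOTONICITY OF CONDITIONAL EXPECTATIONS IN THE BOUNDARY CONDITION: for `ξ₀ ≤ ξ₁` and an increasing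
`h ≥ 0`, `E[h | ω_D = ξ₀] ≤ E[h | ω_D = ξ₁]` ("a positive measure with the FKG lattice condition is monotonic").
[cite: Grimmett2006, §2.2 Thm (2.24) ((b) ⟹ (c)) and Thm (2.19) (Holley inequality)] -/
theorem condexp_mono (hw : ∀ D ξ x, w D ξ x = if (∀ i ∈ D, x i = ξ i) then μ x else 0)
    (hZ : ∀ D ξ, Z D ξ = ∑ x, w D ξ x) (hμ0 : ∀ x, 0 < μ x) (hμ : ∀ a b, μ a * μ b ≤ μ (a ⊓ b) * μ (a ⊔ b))
    (D : Finset ι) {ξ₀ ξ₁ : ι → Bool} (h01 : ξ₀ ≤ ξ₁) {h : (ι → Bool) → ℝ} (hh0 : ∀ x, 0 ≤ h x) (hh : Monotone h) :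
    (∑ x, w D ξ₀ x * h x) / Z D ξ₀ ≤ (∑ x, w D ξ₁ x * h x) / Z D ξ₁ := by
  have hZ0 := Z_pos μ w Z hw hZ hμ0 D ξ₀
  have hZ1 := Z_pos μ w Z hw hZ hμ0 D ξ₁
  have key := holley (fun x => w D ξ₀ x / Z D ξ₀) (fun x => w D ξ₁ x / Z D ξ₁) h
    (fun x => hh0 x) (fun x => div_nonneg (w_nonneg μ w hw hμ0 _ _ _) hZ0.le)
    (fun x => div_nonneg (w_nonneg μ w hw hμ0 _ _ _) hZ1.le) hh
    (by
      show (∑ a, w D ξ₀ a / Z D ξ₀) = ∑ a, w D ξ₁ a / Z D ξ₁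
      rw [← Finset.sum_div, ← Finset.sum_div, ← hZ, ← hZ, div_self hZ0.ne', div_self hZ1.ne'])
    (fun a b => by
      show w D ξ₀ a / Z D ξ₀ * (w D ξ₁ b / Z D ξ₁) ≤ w D ξ₀ (a ⊓ b) / Z D ξ₀ * (w D ξ₁ (a ⊔ b) / Z D ξ₁)
      rw [div_mul_div_comm, div_mul_div_comm]
      exact div_le_div_of_nonneg_right (w_holley μ w hw hμ0 hμ D h01 a b) (mul_nonneg hZ0.le hZ1.le))
  have e0 : ∑ x, h x * (w D ξ₀ x / Z D ξ₀) = (∑ x, w D ξ₀ x * h x) / Z D ξ₀ := by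
    rw [Finset.sum_div]; exact Finset.sum_congr rfl fun x _ => by ring
  have e1 : ∑ x, h x * (w D ξ₁ x / Z D ξ₁) = (∑ x, w D ξ₁ x * h x) / Z D ξ₁ := by
    rw [Finset.sum_div]; exact Finset.sum_congr rfl fun x _ => by ring
  rw [← e0, ← e1]; exact key

omit [Fintype ι] [DecidableEq ι] in
/-- The indicator `𝟙{x_j = 1}` is increasing. [folklore] -/
theorem monotone_ite_apply (j : ι) : Monotone fun x : ι → Bool => (if x j = true then (1 : ℝ) else 0) := by
  intro x y hxy
  dsimp only
  have hj : x j ≤ y j := hxy j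
  by_cases hx : x j = true
  · rw [if_pos hx, if_pos (Bool.le_iff_imp.1 hj hx)]
  · rw [if_neg hx]; split_ifs <;> norm_num

/-- `Eg` is increasing in the boundary condition: `Eg D ξ₀ ≤ Eg D ξ₁` for `ξ₀ ≤ ξ₁` (`g ≥ 0` increasing).
[cite: Grimmett2006, §2.2 Thm (2.24) ((b) ⟹ (c), monotonicity (2.23))] -/
theorem Eg_mono (hw : ∀ D ξ x, w D ξ x = if (∀ i ∈ D, x i = ξ i) then μ x else 0)
    (hZ : ∀ D ξ, Z D ξ = ∑ x, w D ξ x) (hEg : ∀ D ξ, Eg D ξ = (∑ x, w D ξ x * g x) / Z D ξ) (hμ0 : ∀ x, 0 < μ x)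
    (hμ : ∀ a b, μ a * μ b ≤ μ (a ⊓ b) * μ (a ⊔ b)) (hg0 : ∀ x, 0 ≤ g x) (hg : Monotone g) (D : Finset ι)
    {ξ₀ ξ₁ : ι → Bool} (h01 : ξ₀ ≤ ξ₁) : Eg D ξ₀ ≤ Eg D ξ₁ := by
  rw [hEg, hEg]; exact condexp_mono μ w Z hw hZ hμ0 hμ D h01 hg0 hg

/-- `Pr` is increasing in the boundary condition: `Pr D ξ₀ e ≤ Pr D ξ₁ e` for `ξ₀ ≤ ξ₁`, `e ∉ D` (1-monotonicity).
[cite: Grimmett2006, §2.2 Thm (2.24) ((c) ⟹ (d), 1-monotonic)] -/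
theorem Pr_mono (hw : ∀ D ξ x, w D ξ x = if (∀ i ∈ D, x i = ξ i) then μ x else 0)
    (hZ : ∀ D ξ, Z D ξ = ∑ x, w D ξ x) (hPr : ∀ D ξ e, Pr D ξ e = Z (insert e D) (update ξ e true) / Z D ξ)
    (hμ0 : ∀ x, 0 < μ x) (hμ : ∀ a b, μ a * μ b ≤ μ (a ⊓ b) * μ (a ⊔ b)) {D : Finset ι} {e : ι} (he : e ∉ D)
    {ξ₀ ξ₁ : ι → Bool} (h01 : ξ₀ ≤ ξ₁) : Pr D ξ₀ e ≤ Pr D ξ₁ e := by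
  rw [Pr_eq_sum μ w Z Pr hw hZ hPr he, Pr_eq_sum μ w Z Pr hw hZ hPr he]
  exact condexp_mono μ w Z hw hZ hμ0 hμ D h01 (fun x => by positivity) (monotone_ite_apply e)

omit [Fintype ι] in
/-- `ξ^{e→0} ≤ ξ^{e→1}`. [folklore] -/
theorem update_false_le_update_true (ξ : ι → Bool) (e : ι) : update ξ e false ≤ update ξ e true :=
  update_le_update_iff.2 ⟨Bool.false_le _, fun _ _ => le_rfl⟩

omit [Fintype ι] in
/-- `ξ₀ ≤ ξ₁ ⟹ ξ₀^{e→b} ≤ ξ₁^{e→b}`. [folklore] -/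
theorem update_le_update_of_le {ξ₀ ξ₁ : ι → Bool} (h01 : ξ₀ ≤ ξ₁) (e : ι) (b : Bool) :
    update ξ₀ e b ≤ update ξ₁ e b :=
  update_le_update_iff.2 ⟨le_rfl, fun j _ => h01 j⟩

/-! ### The one-edge total-covariance inequality -/

/-- THE ONE-EDGE COVARIANCE IDENTITY: `Cov(g, ω_e | ξ_D) = Pr(1 − Pr)(Eg (D∪e) ξ^{e→1} − Eg (D∪e) ξ^{e→0})` (`e ∉ D`).
[cite: Grimmett2006, §2.2 (2.21) (conditioning on one further edge)] -/
theorem cov_edge_self (hw : ∀ D ξ x, w D ξ x = if (∀ i ∈ D, x i = ξ i) then μ x else 0)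
    (hZ : ∀ D ξ, Z D ξ = ∑ x, w D ξ x) (hPr : ∀ D ξ e, Pr D ξ e = Z (insert e D) (update ξ e true) / Z D ξ)
    (hEg : ∀ D ξ, Eg D ξ = (∑ x, w D ξ x * g x) / Z D ξ) (hμ0 : ∀ x, 0 < μ x) {D : Finset ι} {e : ι} (he : e ∉ D)
    (ξ : ι → Bool) :
    (∑ x, w D ξ x * (g x * if x e = true then 1 else 0)) / Z D ξ
        - Eg D ξ * ((∑ x, w D ξ x * if x e = true then 1 else 0) / Z D ξ)
      = Pr D ξ e * (1 - Pr D ξ e) * (Eg (insert e D) (update ξ e true) - Eg (insert e D) (update ξ e false)) := by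
  rw [condexp_mul_ite μ w Z Pr hw hZ hPr hμ0 he ξ g, ← Pr_eq_sum μ w Z Pr hw hZ hPr he ξ,
    Eg_tower μ g w Z Pr Eg hw hZ hPr hEg hμ0 he ξ, ← hEg]
  ring

/-- THE ONE-EDGE TOTAL-COVARIANCE INEQUALITY: for `e ∉ D` and any coordinate `j`,
`Pr · Cov(g, ω_j | ξ_D, ω_e=1) + (1 − Pr) · Cov(g, ω_j | ξ_D, ω_e=0) ≤ Cov(g, ω_j | ξ_D)` — the defect is the
covariance, under the Bernoulli law of `ω_e`, of the two conditional expectations `E[g | ·]`, `E[ω_j | ·]`, both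
increasing in `ω_e` by Holley monotonicity. [cite: Grimmett2006, §2.2 Thm (2.24) (monotonicity (2.23)) with (2.21)] -/
theorem cov_tower_le (hw : ∀ D ξ x, w D ξ x = if (∀ i ∈ D, x i = ξ i) then μ x else 0)
    (hZ : ∀ D ξ, Z D ξ = ∑ x, w D ξ x) (hPr : ∀ D ξ e, Pr D ξ e = Z (insert e D) (update ξ e true) / Z D ξ)
    (hEg : ∀ D ξ, Eg D ξ = (∑ x, w D ξ x * g x) / Z D ξ) (hμ0 : ∀ x, 0 < μ x)
    (hμ : ∀ a b, μ a * μ b ≤ μ (a ⊓ b) * μ (a ⊔ b)) (hg0 : ∀ x, 0 ≤ g x) (hg : Monotone g) {D : Finset ι} {e : ι}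
    (he : e ∉ D) (ξ : ι → Bool) (j : ι) :
    Pr D ξ e * ((∑ x, w (insert e D) (update ξ e true) x * (g x * if x j = true then 1 else 0))
          / Z (insert e D) (update ξ e true)
        - Eg (insert e D) (update ξ e true) * ((∑ x, w (insert e D) (update ξ e true) x * if x j = true then 1 else 0)
          / Z (insert e D) (update ξ e true)))
      + (1 - Pr D ξ e) * ((∑ x, w (insert e D) (update ξ e false) x * (g x * if x j = true then 1 else 0))
          / Z (insert e D) (update ξ e false)
        - Eg (insert e D) (update ξ e false) * ((∑ x, w (insert e D) (update ξ e false) x * if x j = true then 1 else 0)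
          / Z (insert e D) (update ξ e false)))
      ≤ (∑ x, w D ξ x * (g x * if x j = true then 1 else 0)) / Z D ξ
        - Eg D ξ * ((∑ x, w D ξ x * if x j = true then 1 else 0) / Z D ξ) := by
  -- abbreviations
  set α := Pr D ξ e with hα
  set A₁ := Eg (insert e D) (update ξ e true)
  set A₀ := Eg (insert e D) (update ξ e false)
  set B₁ := (∑ x, w (insert e D) (update ξ e true) x * if x j = true then 1 else 0) / Z (insert e D) (update ξ e true)
  set B₀ := (∑ x, w (insert e D) (update ξ e false) x * if x j = true then 1 else 0) / Z (insert e D) (update ξ e false)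
  have hGJ := condexp_tower μ w Z Pr hw hZ hPr hμ0 he ξ (fun x => g x * if x j = true then 1 else 0)
  have hG := Eg_tower μ g w Z Pr Eg hw hZ hPr hEg hμ0 he ξ
  have hJ := condexp_tower μ w Z Pr hw hZ hPr hμ0 he ξ (fun x => if x j = true then (1 : ℝ) else 0)
  have hA : A₀ ≤ A₁ := Eg_mono μ g w Z Eg hw hZ hEg hμ0 hμ hg0 hg _ (update_false_le_update_true ξ e)
  have hB : B₀ ≤ B₁ :=
    condexp_mono μ w Z hw hZ hμ0 hμ _ (update_false_le_update_true ξ e) (fun x => by positivity) (monotone_ite_apply j)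
  have hα0 : 0 ≤ α := (Pr_pos μ w Z Pr hw hZ hPr hμ0 D ξ e).le
  have hα1 : 0 ≤ 1 - α := by have := Pr_lt_one μ w Z Pr hw hZ hPr hμ0 he ξ; linarith
  rw [hGJ, hG, hJ]
  have key : 0 ≤ α * (1 - α) * ((A₁ - A₀) * (B₁ - B₀)) :=
    mul_nonneg (mul_nonneg hα0 hα1) (mul_nonneg (sub_nonneg.2 hA) (sub_nonneg.2 hB))
  nlinarith [key]

end MonotonicOSSS

end Summit.CriticalPhenomena.PercolationContinuityZ3.Theorems.FK
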